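import Literature.AlgebraicGeometry.HodgeTheory.AbelianVarietyIsotypicComponentsEndomorphismRing
import Literature.AlgebraicGeometry.ComplexMultiplication.FieldOfDegreeTwoDimOnPowers
import Literature.AlgebraicGeometry.ComplexMultiplication.CMTypeOfSimpleSubvariety
import Literature.Geometry.Kaehler.ComplexTorusEndomorphismAlgebraCenter
import Mathlib.RingTheory.SimpleRing.Field
import Mathlib.RingTheory.SimpleRing.Matrix
import Mathlib.RingTheory.SimpleRing.Congr
import HarnessLib

/-!
# The centre of `End⁰(X)` along the isotypic decomposition: `Z(End⁰ X) ≅ ∏_q Z(End⁰ Y_q) ≅ ∏_q Z(End⁰ B_q)`, and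
# Silverberg–Zarhin's Lemma 3.3 «`Z(End⁰ X)` is a field iff `X` is isotypic» (perfect field)

Layer `Literature/AlgebraicGeometry/HodgeTheory`; theorems only (no `def`, no instance, no named fact; net debt 0).  Sequel of
`HodgeTheory/AbelianVarietyIsotypicComponentsEndomorphismRing` (seat p03 GEN 52 row 1: `End⁰(X) ≃ₐ[ℚ] ∏_q End⁰(Y_q)` along
`Hom`-orthogonal components whose addition map is an isogeny; Mumford §19 Cor. 2 `End⁰(X) ≃ₐ[ℚ] ∏_q M_{n_q+1}(End⁰ B_q)`).

THE PRINT.  A. Silverberg, Yu. G. Zarhin, *Isogenies of abelian varieties over finite fields* (2015), held `paper:arxiv-1409.0592`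
p. 5 L26–L57, **Lemma 3.3** «Suppose `A` is a positive dimensional abelian variety over a field `F`. Then `Z_F(A)` is a number
field if and only if `A` is `F`-isotypic.» with its proof: «if `X` is a simple positive dimensional abelian variety over `F` then
`End_F^0(X)` is a finite-dimensional division algebra over `ℚ` and therefore its center `Z_F(X)` is a number field. If `A` is
`F`-isotypic, then `A` is `F`-isogenous to `X^n` … an algebra isomorphism between `End_F^0(A)` and the matrix algebra of size `n`
over `End_F^0(X)`. This implies that the centers of `End_F^0(X)` and `End_F^0(A)` are canonically isomorphic … Since
`Hom_F(X,Y) = 0` when `X, Y ∈ I_A(F)` and `X ≠ Y`, we have `End_F^0(∏ X) = ⊕ End_F^0(X)` … the isogeny `S` induces an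
isomorphism `End_F^0(A) ≅ ⊕ End_F^0(X)`. This implies that `Z_F(A) ≅ Z_F(∏ X) = ⊕_{X ∈ I_A(F)} Z_F(X)`. It follows that `Z_F(A)`
is a number field if and only if `#I_A(F) = 1`, i.e., if and only if `A` is `F`-isotypic.»  Shimura 1998 §5.1 proof of Prop. 4
(«`End_Q(A)` is identified with the total matrix ring of degree `h` over `End_Q(B)`; hence `K` [the centre of `End_Q(B)`] is
the center of `End_Q(A)`»); Mumford §19 Cor. 2 of Thm. 1 (p. 174).

THE ARGUMENT, as printed.  §1 (algebra): a product of rings over an index type with two distinct points is never a field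
(`δ_{q₀}` is a zero divisor); the centre of a simple ring, read as a `ℚ`-subalgebra, is a field (Mathlib
`IsSimpleRing.isField_center`).  The centre of a product ∕ of a matrix algebra ∕ of a division algebra and centres along
`≃ₐ` are the tree's `Geometry.Kaehler.AlgCenter.centerPi` ∕ `centerMatrix` ∕ `isField_center_of_isUnit_or_eq_zero` ∕ `congr`
(CITED, not restated).  §2 (any field): `Z(End⁰ X) ≅ Z(∏_q End⁰ Y_q) = ∏_q Z(End⁰ Y_q)` along `Hom`-orthogonal components
(row 1's `End⁰(X) ≃ₐ[ℚ] ∏_q End⁰(Y_q)`).  §3 (perfect field): for `X ∼ ⨁_q B_q^{n_q+1}` (simple pairwise non-isogenous `B_q` of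
positive dimension) `Z(End⁰ X) ≅ ∏_q Z(M_{n_q+1}(End⁰ B_q)) ≅ ∏_q Z(End⁰ B_q)` (row 1's Mumford Cor. 2 and the centre of a
matrix algebra), `dim_ℚ Z(End⁰ X) = Σ_q dim_ℚ Z(End⁰ B_q)`; Lemma 3.3: `⟸` `Z(End⁰ X) ≅ Z(End⁰ C)` is the centre of a
division algebra (`ComplexMultiplication.endAlgebra_exists_inv_of_isSimple`); `⟹` in the isotypic decomposition of `X`
(`exists_isotypicComponents_orthogonal`) the number `r` of types is `1` — `r = 0` forces `dim X = 0`, and for `r ≥ 2` the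
product `∏_q Z(End⁰ B_q)` has zero divisors.  §4: the centre is a field iff `End⁰(X)` is a simple ring (`⟸` Mathlib;
`⟹` Lemma 3.3 and `End⁰(X) ≅ M_{m+1}(End⁰ C)` with `End⁰(C)` a division algebra, Mathlib `IsSimpleRing.matrix`).

Results (namespace `Literature.AlgebraicGeometry.HodgeTheory.AbelianVariety`):
* §1 `not_isField_pi_of_ne` (products over an index type with two distinct points are not fields),
  `isField_center_rat_of_isSimpleRing` (`Z(A)` as a `ℚ`-subalgebra is a field for a simple ring `A`);
* §2 (any field) **`nonempty_center_endAlgebra_algEquiv_pi_components`** (`Z(End⁰ X) ≃ₐ[ℚ] ∏_q Z(End⁰ Y_q)`),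
  **`finrank_center_endAlgebra_eq_sum_components`**;
* §3 `nonempty_center_endAlgebra_algEquiv_center_of_isIsogenous_biproduct_const` (`Y ∼ B^{m+1} ⟹ Z(End⁰ Y) ≃ₐ[ℚ] Z(End⁰ B)`,
  any field), then over a perfect field **`nonempty_center_endAlgebra_algEquiv_pi_of_isIsogenous`**
  (`Z(End⁰ X) ≃ₐ[ℚ] ∏_q Z(End⁰ B_q)`), `nonempty_center_endAlgebra_algEquiv_pi_isotypicComponents`,
  **`finrank_center_endAlgebra_eq_sum`**, `exists_center_endAlgebra_algEquiv_pi` (for EVERY `X`),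
  **`isField_center_endAlgebra_of_isIsogenous_biproduct_const`** (any field),
  **`isField_center_endAlgebra_iff_exists_isIsogenous_biproduct_const`** (LEMMA 3.3);
* §4 **`isField_center_endAlgebra_iff_isSimpleRing`** (`dim X > 0`, perfect field: `Z(End⁰ X)` is a field iff `End⁰(X)` is
  simple).

## References
* [SilverbergZarhin2015] A. Silverberg, Yu. G. Zarhin, *Isogenies of abelian varieties over finite fields*, Des. Codes Cryptogr. 77
  (2015) (arXiv:1409.0592), §2 (notation `Z_F`), Def. 2.2–2.3, Lemma 3.3 with proof (p. 5).
* [Shimura1998] G. Shimura, *Abelian Varieties with Complex Multiplication and Modular Functions* (1998), §5.1, proofs of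
  Propositions 3 and 4.
* [MumfordAV1970] D. Mumford, *Abelian Varieties* (1970), §19 Thm. 1, Cor. 1–2 (pp. 173–174).
* [Milne1986AbelianVarieties] J. S. Milne, *Abelian Varieties*, in Cornell–Silverman, *Arithmetic Geometry* (1986), §12 p. 122.
-/

noncomputable section

universe u

open CategoryTheory CategoryTheory.Limits

namespace Literature.AlgebraicGeometry.HodgeTheory

namespace AbelianVariety

open _root_.AlgebraicGeometry
open Literature.AlgebraicGeometry.Motives Literature.AlgebraicGeometry.Motives.AbelianVariety
open Literature.AlgebraicGeometry.ComplexMultiplication (endAlgebra_exists_inv_of_isSimple)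
open Literature.Geometry.Kaehler (AlgCenter.congr AlgCenter.centerPi AlgCenter.centerMatrix
  AlgCenter.isField_center_of_isUnit_or_eq_zero)

/-! ## §1 Algebra: products are not fields; the centre of a simple ring -/

section Algebra

/-- **A product of rings over an index type with two distinct points (all factors non-trivial) is not a field**: `δ_{q₀}` is
not invertible (`(δ_{q₀} · b)_{q₁} = 0 ≠ 1`). [cite: SilverbergZarhin2015, proof of Lemma 3.3 (p. 5: «Z_F(A) is a number field if and only if #I_A(F) = 1»)] -/
theorem not_isField_pi_of_ne {Q : Type} {C : Q → Type*} [∀ q, Ring (C q)] [∀ q, Nontrivial (C q)] {q₀ q₁ : Q}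
    (hq : q₀ ≠ q₁) : ¬ IsField (∀ q, C q) := by
  classical
  intro hF
  have h0 : (Pi.single q₀ (1 : C q₀) : ∀ q, C q) ≠ 0 := fun h ↦
    one_ne_zero (α := C q₀) (by simpa using congrFun h q₀)
  obtain ⟨b, hb⟩ := hF.mul_inv_cancel h0
  have h1 := congrFun hb q₁
  rw [Pi.mul_apply, Pi.single_eq_of_ne hq.symm, zero_mul, Pi.one_apply] at h1
  exact zero_ne_one h1

/-- `Z(A)` as a `ℚ`-subalgebra is a field when the ring `A` is simple (Mathlib `IsSimpleRing.isField_center` for the subring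
centre, transported along the identity map `Subalgebra.center ℚ A ≃* Subring.center A`). [cite: SilverbergZarhin2015, proof of Lemma 3.3 (p. 5)] -/
theorem isField_center_rat_of_isSimpleRing {A : Type*} [Ring A] [Algebra ℚ A] [IsSimpleRing A] :
    IsField (Subalgebra.center ℚ A) := by
  let e : Subalgebra.center ℚ A ≃* Subring.center A :=
    { toFun := fun z ↦ ⟨z, Subring.mem_center_iff.2 (Subalgebra.mem_center_iff.1 z.2)⟩
      invFun := fun z ↦ ⟨z, Subalgebra.mem_center_iff.2 (Subring.mem_center_iff.1 z.2)⟩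
      left_inv := fun _ ↦ rfl
      right_inv := fun _ ↦ rfl
      map_mul' := fun _ _ ↦ rfl }
  exact MulEquiv.isField (IsSimpleRing.isField_center A) e

end Algebra

/-! ## §2 `Z(End⁰ X) ≅ ∏_q Z(End⁰ Y_q)` along `Hom`-orthogonal components (any field) -/

section Components

variable {K : Type u} [Field K] {Q : Type} [Fintype Q] {X : Motives.AbelianVariety K} {Y : Q → Motives.AbelianVariety K}
  (i : ∀ q, Y q ⟶ X)

/-- **`Z(End⁰ X) ≃ₐ[ℚ] ∏_q Z(End⁰ Y_q)`** for abelian subvarieties `i_q : Y_q ↪ X` with `Hom(Y_q, Y_{q'}) = 0` (`q ≠ q'`) whose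
addition map is an isogeny (any field): «the isogeny `S` induces an isomorphism `End_F^0(A) ≅ ⊕ End_F^0(X)`. This implies that
`Z_F(A) ≅ Z_F(∏ X) = ⊕_{X ∈ I_A(F)} Z_F(X)`». [cite: SilverbergZarhin2015, proof of Lemma 3.3 (p. 5)] [cite: MumfordAV1970, §19 Cor. 2 of Thm. 1 (p. 174)] -/
theorem nonempty_center_endAlgebra_algEquiv_pi_components (hi : ∀ q, IsClosedImmersion (Hom.toSchemeHom (i q)))
    (hdesc : IsIsogeny (biproduct.desc i)) (horth : ∀ q q', q ≠ q' → ∀ f : Y q ⟶ Y q', f = 0) :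
    Nonempty (Subalgebra.center ℚ X.endAlgebra ≃ₐ[ℚ] ∀ q, Subalgebra.center ℚ (Y q).endAlgebra) := by
  obtain ⟨e⟩ := nonempty_algEquiv_endAlgebra_pi_components i hi hdesc horth
  exact ⟨(AlgCenter.congr e).trans AlgCenter.centerPi⟩

/-- **`dim_ℚ Z(End⁰ X) = Σ_q dim_ℚ Z(End⁰ Y_q)`** along `Hom`-orthogonal components whose addition map is an isogeny (any
field). [cite: SilverbergZarhin2015, proof of Lemma 3.3 (p. 5)] [cite: MumfordAV1970, §19 Cor. 2 of Thm. 1 (p. 174)] -/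
theorem finrank_center_endAlgebra_eq_sum_components (hi : ∀ q, IsClosedImmersion (Hom.toSchemeHom (i q)))
    (hdesc : IsIsogeny (biproduct.desc i)) (horth : ∀ q q', q ≠ q' → ∀ f : Y q ⟶ Y q', f = 0) :
    Module.finrank ℚ (Subalgebra.center ℚ X.endAlgebra) = ∑ q, Module.finrank ℚ (Subalgebra.center ℚ (Y q).endAlgebra) := by
  classical
  obtain ⟨e⟩ := nonempty_center_endAlgebra_algEquiv_pi_components i hi hdesc horth
  haveI : ∀ q, Module.Free ℚ (Subalgebra.center ℚ (Y q).endAlgebra) := fun q ↦ Module.Free.of_divisionRing ℚ _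
  -- `FiniteDimensional ℚ End⁰` handed over explicitly (instance search does not bridge the two `AddCommMonoid` paths of
  -- the type synonym `endAlgebra`)
  haveI : ∀ q, Module.Finite ℚ (Subalgebra.center ℚ (Y q).endAlgebra) := fun q ↦
    @FiniteDimensional.finiteDimensional_subalgebra ℚ (Y q).endAlgebra _ _ _ (finiteDimensional_endAlgebra_holds (Y q))
      (Subalgebra.center ℚ (Y q).endAlgebra)
  rw [e.toLinearEquiv.finrank_eq, Module.finrank_pi_fintype]

end Components

/-! ## §3 `Z(End⁰ X) ≅ ∏_q Z(End⁰ B_q)` and Silverberg–Zarhin's Lemma 3.3 (perfect field) -/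

section Perfect

variable {K : Type u} [Field K]

/-- **`Y ∼ B^{m+1} ⟹ Z(End⁰ Y) ≃ₐ[ℚ] Z(End⁰ B)`** (any field): `End⁰(Y) ≅ M_{m+1}(End⁰ B)` (row 1) and the centre of a matrix
algebra is the centre of the coefficients, as scalar matrices («the centers of `End_F^0(X)` and `End_F^0(A)` are canonically
isomorphic»; Shimura: «hence `K` is the center of `End_Q(A)`»). [cite: SilverbergZarhin2015, proof of Lemma 3.3 (p. 5)]
[cite: Shimura1998, §5.1 Proposition 4 (proof)] -/
theorem nonempty_center_endAlgebra_algEquiv_center_of_isIsogenous_biproduct_const {B Y : Motives.AbelianVariety K} {m : ℕ}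
    (hY : IsIsogenous Y (⨁ fun _ : Fin (m + 1) ↦ B)) :
    Nonempty (Subalgebra.center ℚ Y.endAlgebra ≃ₐ[ℚ] Subalgebra.center ℚ B.endAlgebra) := by
  obtain ⟨e⟩ := nonempty_algEquiv_endAlgebra_matrix_of_isIsogenous_biproduct_const hY
  exact ⟨(AlgCenter.congr e).trans AlgCenter.centerMatrix⟩

variable [PerfectField K] {Q : Type} [Fintype Q] {B : Q → Motives.AbelianVariety K} {n : Q → ℕ}
  {X : Motives.AbelianVariety K} {Y : Q → Motives.AbelianVariety K}

/-- **`Z(End⁰ X) ≃ₐ[ℚ] ∏_q Z(End⁰ B_q)` for `X ∼ ⨁_q B_q^{n_q+1}`** with `B_q` simple of positive dimension and pairwise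
non-isogenous (perfect field): `Z(End⁰ X) ≅ Z(∏_q End⁰(B_q^{n_q+1})) = ∏_q Z(M_{n_q+1}(End⁰ B_q)) ≅ ∏_q Z(End⁰ B_q)`.
[cite: SilverbergZarhin2015, proof of Lemma 3.3 (p. 5)] [cite: Shimura1998, §5.1 Proposition 4 (proof)] [cite: MumfordAV1970, §19 Cor. 2 of Thm. 1 (p. 174)] -/
theorem nonempty_center_endAlgebra_algEquiv_pi_of_isIsogenous (hB : ∀ q, (B q).IsSimple) (hB0 : ∀ q, 0 < (B q).dim)
    (hni : ∀ q q', q ≠ q' → ¬ IsIsogenous (B q) (B q'))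
    (hX : IsIsogenous X (⨁ fun q ↦ ⨁ fun _ : Fin (n q + 1) ↦ B q)) :
    Nonempty (Subalgebra.center ℚ X.endAlgebra ≃ₐ[ℚ] ∀ q, Subalgebra.center ℚ (B q).endAlgebra) := by
  classical
  obtain ⟨e₀⟩ := hX.nonempty_endAlgebra_algEquiv
  have horth : ∀ q q', q ≠ q' → ∀ f : (⨁ fun _ : Fin (n q + 1) ↦ B q) ⟶ (⨁ fun _ : Fin (n q' + 1) ↦ B q'), f = 0 :=
    fun q q' hqq' f ↦ hom_eq_zero_of_isIsogenous_biproduct_const_of_ne hB hB0 hni hqq' (IsIsogenous.refl _)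
      (IsIsogenous.refl _) f
  obtain ⟨e₁, -⟩ := nonempty_algEquiv_endAlgebra_biproduct_pi (A := fun q ↦ ⨁ fun _ : Fin (n q + 1) ↦ B q) horth
  have e₄ : ∀ q, Subalgebra.center ℚ (⨁ fun _ : Fin (n q + 1) ↦ B q).endAlgebra ≃ₐ[ℚ] Subalgebra.center ℚ (B q).endAlgebra :=
    fun q ↦ Classical.choice
      (nonempty_center_endAlgebra_algEquiv_center_of_isIsogenous_biproduct_const (IsIsogenous.refl _))
  exact ⟨((AlgCenter.congr (e₀.trans e₁)).trans AlgCenter.centerPi).trans (AlgEquiv.piCongrRight e₄)⟩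

/-- **`Z(End⁰ X) ≃ₐ[ℚ] ∏_q Z(End⁰ B_q)` along a system of isotypic components** `Y_q ↪ X`, `Y_q ∼ B_q^{n_q+1}`, whose addition map
is an isogeny (perfect field). [cite: SilverbergZarhin2015, proof of Lemma 3.3 (p. 5)] [cite: MumfordAV1970, §19 Cor. 2 of Thm. 1 (p. 174)] -/
theorem nonempty_center_endAlgebra_algEquiv_pi_isotypicComponents (hB : ∀ q, (B q).IsSimple) (hB0 : ∀ q, 0 < (B q).dim)
    (hni : ∀ q q', q ≠ q' → ¬ IsIsogenous (B q) (B q'))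
    (hY : ∀ q, IsIsogenous (Y q) (⨁ fun _ : Fin (n q + 1) ↦ B q)) (i : ∀ q, Y q ⟶ X)
    (hdesc : IsIsogeny (biproduct.desc i)) :
    Nonempty (Subalgebra.center ℚ X.endAlgebra ≃ₐ[ℚ] ∀ q, Subalgebra.center ℚ (B q).endAlgebra) := by
  obtain ⟨f, hf⟩ := exists_isIsogeny_biproduct_map_of_isIsogenous hY
  exact nonempty_center_endAlgebra_algEquiv_pi_of_isIsogenous hB hB0 hni
    ((show IsIsogenous (⨁ Y) X from ⟨biproduct.desc i, hdesc⟩).symm'.trans ⟨biproduct.map f, hf⟩)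

/-- **`dim_ℚ Z(End⁰ X) = Σ_q dim_ℚ Z(End⁰ B_q)`** for `X ∼ ⨁_q B_q^{n_q+1}` (perfect field).
[cite: SilverbergZarhin2015, proof of Lemma 3.3 (p. 5)] [cite: Shimura1998, §5.1 Proposition 4 (proof: «2n = fgh, 2m = fg»)] -/
theorem finrank_center_endAlgebra_eq_sum (hB : ∀ q, (B q).IsSimple) (hB0 : ∀ q, 0 < (B q).dim)
    (hni : ∀ q q', q ≠ q' → ¬ IsIsogenous (B q) (B q'))
    (hX : IsIsogenous X (⨁ fun q ↦ ⨁ fun _ : Fin (n q + 1) ↦ B q)) :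
    Module.finrank ℚ (Subalgebra.center ℚ X.endAlgebra) = ∑ q, Module.finrank ℚ (Subalgebra.center ℚ (B q).endAlgebra) := by
  classical
  obtain ⟨e⟩ := nonempty_center_endAlgebra_algEquiv_pi_of_isIsogenous hB hB0 hni hX
  haveI : ∀ q, Module.Free ℚ (Subalgebra.center ℚ (B q).endAlgebra) := fun q ↦ Module.Free.of_divisionRing ℚ _
  -- `FiniteDimensional ℚ End⁰` handed over explicitly (instance search does not bridge the two `AddCommMonoid` paths of
  -- the type synonym `endAlgebra`)
  haveI : ∀ q, Module.Finite ℚ (Subalgebra.center ℚ (B q).endAlgebra) := fun q ↦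
    @FiniteDimensional.finiteDimensional_subalgebra ℚ (B q).endAlgebra _ _ _ (finiteDimensional_endAlgebra_holds (B q))
      (Subalgebra.center ℚ (B q).endAlgebra)
  rw [e.toLinearEquiv.finrank_eq, Module.finrank_pi_fintype]

omit [Fintype Q] in
/-- **For EVERY abelian variety `X` over a perfect field**: simple pairwise non-isogenous `B_q` of positive dimension and exponents
with `X ∼ ⨁_q B_q^{n_q+1}` and `Z(End⁰ X) ≃ₐ[ℚ] ∏_q Z(End⁰ B_q)`. [cite: SilverbergZarhin2015, proof of Lemma 3.3 (p. 5)]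
[cite: MumfordAV1970, §19 Cor. 1–2 of Thm. 1 (pp. 173–174)] -/
theorem exists_center_endAlgebra_algEquiv_pi (X : Motives.AbelianVariety K) :
    ∃ (r : ℕ) (B : Fin r → Motives.AbelianVariety K) (n : Fin r → ℕ),
      (∀ q, (B q).IsSimple) ∧ (∀ q, 0 < (B q).dim) ∧ (∀ q q', q ≠ q' → ¬ IsIsogenous (B q) (B q')) ∧
        IsIsogenous X (⨁ fun q ↦ ⨁ fun _ : Fin (n q + 1) ↦ B q) ∧
          Nonempty (Subalgebra.center ℚ X.endAlgebra ≃ₐ[ℚ] ∀ q, Subalgebra.center ℚ (B q).endAlgebra) := by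
  obtain ⟨r, B, n, hB, hB0, hni, hX, -⟩ := exists_algEquiv_endAlgebra_pi_matrix X
  exact ⟨r, B, n, hB, hB0, hni, hX, nonempty_center_endAlgebra_algEquiv_pi_of_isIsogenous hB hB0 hni hX⟩

omit [PerfectField K] [Fintype Q] in
/-- **An isotypic abelian variety has a field as the centre of `End⁰`** (any field): if `X ∼ C^{m+1}` with `C` simple of
positive dimension, then `Z(End⁰ X) ≅ Z(End⁰ C)` is the centre of the division algebra `End⁰(C)`, a field.
[cite: SilverbergZarhin2015, Lemma 3.3 with proof (p. 5)] [cite: MumfordAV1970, §19 Cor. 2 of Thm. 1 (p. 174)] -/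
theorem isField_center_endAlgebra_of_isIsogenous_biproduct_const {C : Motives.AbelianVariety K} (hC : C.IsSimple)
    (hC0 : 0 < C.dim) {m : ℕ} (hX : IsIsogenous X (⨁ fun _ : Fin (m + 1) ↦ C)) :
    IsField (Subalgebra.center ℚ X.endAlgebra) := by
  obtain ⟨e⟩ := nonempty_center_endAlgebra_algEquiv_center_of_isIsogenous_biproduct_const hX
  haveI : Nontrivial C.endAlgebra := ComplexMultiplication.FieldOnPowers.nontrivial_endAlgebra_of_dim_pos hC0
  have hC' : IsField (Subalgebra.center ℚ C.endAlgebra) :=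
    AlgCenter.isField_center_of_isUnit_or_eq_zero fun x ↦ by
      by_cases hx : x = 0
      · exact Or.inr hx
      · obtain ⟨y, hxy, hyx⟩ := endAlgebra_exists_inv_of_isSimple hC x hx
        exact Or.inl ⟨⟨x, y, hxy, hyx⟩, rfl⟩
  exact MulEquiv.isField hC' e.toMulEquiv

/-- **SILVERBERG–ZARHIN LEMMA 3.3: for `X` of positive dimension over a perfect field, the centre `Z(End⁰ X)` is a field if and
only if `X` is isotypic** (`X ∼ C^{n+1}` for a simple `C` of positive dimension).  `⟹`: in the isotypic decomposition
`X ∼ ⨁_{q<r} B_q^{n_q+1}` one has `Z(End⁰ X) ≅ ∏_{q<r} Z(End⁰ B_q)`; `r = 0` would force `dim X = 0`, and for `r ≥ 2` the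
product has zero divisors; so `r = 1`. [cite: SilverbergZarhin2015, Lemma 3.3 with proof (p. 5: «Z_F(A) is a number field if and only if #I_A(F) = 1, i.e., if and only if A is F-isotypic»)]
[cite: MumfordAV1970, §19 Cor. 1–2 of Thm. 1 (pp. 173–174)] -/
theorem isField_center_endAlgebra_iff_exists_isIsogenous_biproduct_const (hX0 : 0 < X.dim) :
    IsField (Subalgebra.center ℚ X.endAlgebra) ↔
      ∃ (C : Motives.AbelianVariety K) (m : ℕ), C.IsSimple ∧ 0 < C.dim ∧ IsIsogenous X (⨁ fun _ : Fin (m + 1) ↦ C) := by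
  refine ⟨fun hF ↦ ?_, fun ⟨C, m, hC, hC0, hX⟩ ↦ isField_center_endAlgebra_of_isIsogenous_biproduct_const hC hC0 hX⟩
  obtain ⟨r, B, n, hB, hB0, hni, hX, ⟨e⟩⟩ := exists_center_endAlgebra_algEquiv_pi X
  have hF' : IsField (∀ q : Fin r, Subalgebra.center ℚ (B q).endAlgebra) := MulEquiv.isField hF e.symm.toMulEquiv
  haveI : ∀ q : Fin r, Nontrivial (B q).endAlgebra := fun q ↦
    ComplexMultiplication.FieldOnPowers.nontrivial_endAlgebra_of_dim_pos (hB0 q)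
  -- `r = 1`: `r = 0` contradicts `0 < dim X`, `r ≥ 2` contradicts `hF'`
  rcases Nat.lt_trichotomy r 1 with hr | hr | hr
  · exfalso
    have hr0 : r = 0 := by omega
    subst hr0
    rw [hX.dim_eq, dim_biproduct, Finset.univ_eq_empty, Finset.sum_empty] at hX0
    exact lt_irrefl 0 hX0
  · subst hr
    refine ⟨B 0, n 0, hB 0, hB0 0, hX.trans ⟨(biproductUniqueIso fun q : Fin 1 ↦ ⨁ fun _ : Fin (n q + 1) ↦ B q).hom,
      isIsogeny_hom_of_iso _⟩⟩
  · exfalso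
    exact not_isField_pi_of_ne (C := fun q : Fin r ↦ Subalgebra.center ℚ (B q).endAlgebra) (q₀ := ⟨0, by omega⟩)
      (q₁ := ⟨1, hr⟩) (fun h ↦ absurd (congrArg Fin.val h) (by norm_num)) hF'

end Perfect

/-! ## §4 The centre is a field iff `End⁰(X)` is simple (perfect field) -/

section Simple

variable {K : Type u} [Field K] {X : Motives.AbelianVariety K}

/-- **For `X` of positive dimension over a perfect field, `Z(End⁰ X)` is a field iff `End⁰(X)` is a simple ring** (both say:
`X` is isotypic). [cite: SilverbergZarhin2015, Lemma 3.3 with proof (p. 5)] [cite: MumfordAV1970, §19 Cor. 2 of Thm. 1 (p. 174)] -/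
theorem isField_center_endAlgebra_iff_isSimpleRing [PerfectField K] (hX0 : 0 < X.dim) :
    IsField (Subalgebra.center ℚ X.endAlgebra) ↔ IsSimpleRing X.endAlgebra := by
  refine ⟨fun hF ↦ ?_, fun _ ↦ isField_center_rat_of_isSimpleRing⟩
  obtain ⟨C, m, hC, hC0, hX⟩ := (isField_center_endAlgebra_iff_exists_isIsogenous_biproduct_const hX0).1 hF
  -- `End⁰(X) ≅ M_{m+1}(End⁰ C)` with `End⁰(C)` a division algebra: a simple ring
  haveI : Nontrivial C.endAlgebra := ComplexMultiplication.FieldOnPowers.nontrivial_endAlgebra_of_dim_pos hC0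
  letI : DivisionRing C.endAlgebra := DivisionRing.ofIsUnitOrEqZero fun x ↦ by
    by_cases hx : x = 0
    · exact Or.inr hx
    · obtain ⟨y, hxy, hyx⟩ := endAlgebra_exists_inv_of_isSimple hC x hx
      exact Or.inl ⟨⟨x, y, hxy, hyx⟩, rfl⟩
  obtain ⟨e⟩ := nonempty_algEquiv_endAlgebra_matrix_of_isIsogenous_biproduct_const hX
  exact IsSimpleRing.of_ringEquiv e.symm.toRingEquiv inferInstance

end Simple

end AbelianVariety

end Literature.AlgebraicGeometry.HodgeTheory

end
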